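import Summits.AtomisticToContinuum.Crystallization.Theorems.ChartedZeroExcessLayeredLatticeLiouvilleZZZYRCT

/-!
# Charted zero-excess layered-lattice Liouville — ZZZYRCV: the BOX-AWARE king remainder (per-vector kernel on a certified vector set)

Cell `decomp-a2c`, lens 2 «structural dichotomy (special | generic)», generation 99.  Critic r1841 locked `D_enum = 24` with the BOX-AWARE
remainder «ZZZYRCV» in the `sin² ≤ 1` reading; lens-2's price line (STATUS 2026-09-04T14:09Z) fixed the provable shape as a THREE-WAY cover of
the far pairs: NEAR (census data, ideal length `≤ 24`) + MIDDLE (ideal length `> 24`, actual length `≤ 64`; king paths; ONE kernel-decided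
universal table) + FAR-FAR (actual length `> 64`; the generic king remainder RCR/RCQ already on the tree).  This file is the MIDDLE piece,
stated over an abstract certified vector set so that it is independent of the word / residue / box and of the reader's data definitions:

* §1 per-vector king data: `kingNv v` (king length of an index vector; `kingN x = kingNv (x.2 − x.1)` by `rfl`), the KING RUN COUNT
  `kcnt v δ = #{i < kingNv v : kstep v i = δ}` and the per-vector coefficient `kcoef F v = kingNv v · 45927 / F v⁴` (`45927 = 7·9⁴`:
  `a₋(r) ≤ 7/r⁸` and `9 r² ≥ λ²·F`);
* §2 `schemeCoefR_king_le / schemeCoefN_king_le`: on a pair `x` whose squared length is floored by `λ²·F(x.2 − x.1)/9`, every king-piece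
  increment is `≤ (1+α)·λ⁻⁸·kcoef F v` (resp. `(1+α⁻¹)·λ⁻⁸·…`, `sin² ≤ 1`) — `aMinus_le_div` (RCP) and `cosSq ∈ [0,1]` (RCHA);
* §3 `card_pieces_king_le`: among pairs with a FIXED index difference `v`, at most `kcnt v (y.2 − y.1)` (pair, index) incidences hit a
  fixed piece `y` (translation pins the pair: `kingZ_succ_sub_eq_kstep`, RCQ); `king_table_core`: regrouping `x ↦ x.2 − x.1 ∈ M`;
* §4 ★ `schemeDominatedOnP_king_table`: for ANY class `P` whose far members have their index difference in a finite set `M` with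
  `0 < F v` and `λ²·F v ≤ 9‖e_x‖²`, and any table `T` with `Σ_{v ∈ M} kcnt v δ · kcoef F v ≤ T δ` for every step `δ`, the king path system
  satisfies `SchemeDominatedOnP ϱ α a b w kingN kingZ P (fun y ↦ (1+α)·λ⁻⁸·T (y.2 − y.1)) (fun y ↦ (1+α⁻¹)·λ⁻⁸·T (y.2 − y.1))`.

USE (reader core «ZZZYRCX» + the K-files «ZZZYRCVK»): `P x := 5184 < n9W wd (toBase x) ∧ ‖e_x‖ ≤ 64`, `F v` = the registry floor
`min_{|d| ≤ 2} qhex(3v₀+d, 3v₁+d) + 6v₂²`, `M` = `{v : Fmax v > 5184 ∧ F v ≤ HI2}` as a filtered cube, `T δ = Ξ(δ)/2^60` from the kernel-decided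
table (desk/rcv_tab.py: `max_δ Ξ/2^60 = 3.04e-4`).  The path-system half (`IsPathSystemOn … kingN kingZ`) is `isPathSystem_king` (RCP).

Theorem file (3 defs, 8 theorems); imports the tree's ZZZYRCT; no instance / notation / option; 0 sorry. [g99]
-/

namespace Summit.AtomisticToContinuum.Crystallization.Theorems.ChartedZeroExcessLayeredLatticeLiouville

open scoped BigOperators RealInnerProductSpace
open Summit.AtomisticToContinuum.Crystallization.Theorems.ChartedPlanarOrderRigidityDoor (E3)

/-! ### §1 Per-vector king data -/

/-- king length of an index vector: the sup norm. [g99] -/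
def kingNv (v : Cell 2 × ℤ) : ℕ := max (max (v.1 0).natAbs (v.1 1).natAbs) v.2.natAbs

/-- `kingN x` depends only on the index difference. [g99] -/
theorem kingN_eq_kingNv (x : (Cell 2 × ℤ) × (Cell 2 × ℤ)) : kingN x = kingNv (x.2 - x.1) := rfl

/-- ★ the KING RUN COUNT: the number of steps of type `δ` on the king path of the index vector `v`. [g99] -/
noncomputable def kcnt (v δ : Cell 2 × ℤ) : ℕ := ((Finset.range (kingNv v)).filter fun i => kstep v i = δ).card

/-- the per-vector kernel coefficient `n(v)·45927/F(v)⁴` (`45927 = 7·9⁴`). [g99] -/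
noncomputable def kcoef (F : Cell 2 × ℤ → ℕ) (v : Cell 2 × ℤ) : ℝ := (kingNv v : ℝ) * 45927 / (F v : ℝ) ^ 4

/-- `kcoef ≥ 0`. [g99] -/
theorem kcoef_nonneg (F : Cell 2 × ℤ → ℕ) (v : Cell 2 × ℤ) : 0 ≤ kcoef F v :=
  div_nonneg (mul_nonneg (Nat.cast_nonneg _) (by norm_num)) (pow_nonneg (Nat.cast_nonneg _) 4)

/-! ### §2 The pointwise coefficient bound -/

/-- the radial kernel under a squared-length floor: `λ²·F ≤ 9 r²`, `0 < F`, `0 < λ` ⇒ `n·a₋(r) ≤ λ⁻⁸ · n·45927/F⁴`. [g99] -/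
theorem king_kernel_le {lam r : ℝ} (hlam : 0 < lam) {F n : ℕ} (hF : 0 < F) (hfl : lam ^ 2 * (F : ℝ) ≤ 9 * r ^ 2) :
    (n : ℝ) * aMinus r ≤ (lam ^ 8)⁻¹ * ((n : ℝ) * 45927 / (F : ℝ) ^ 4) := by
  have hF' : (0 : ℝ) < F := by exact_mod_cast hF
  have hq : 0 < lam ^ 2 * (F : ℝ) / 9 := by positivity
  have hr2 : lam ^ 2 * (F : ℝ) / 9 ≤ r ^ 2 := by linarith
  have h8 : (lam ^ 2 * (F : ℝ) / 9) ^ 4 ≤ r ^ 8 := by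
    have := pow_le_pow_left₀ hq.le hr2 4
    calc (lam ^ 2 * (F : ℝ) / 9) ^ 4 ≤ (r ^ 2) ^ 4 := this
      _ = r ^ 8 := by ring
  have h1 : aMinus r ≤ 7 / (lam ^ 2 * (F : ℝ) / 9) ^ 4 :=
    (aMinus_le_div r).trans (div_le_div_of_nonneg_left (by norm_num) (by positivity) h8)
  have h2 : 7 / (lam ^ 2 * (F : ℝ) / 9) ^ 4 = (lam ^ 8)⁻¹ * (45927 / (F : ℝ) ^ 4) := by
    field_simp
    ring
  calc (n : ℝ) * aMinus r ≤ (n : ℝ) * (7 / (lam ^ 2 * (F : ℝ) / 9) ^ 4) := mul_le_mul_of_nonneg_left h1 (Nat.cast_nonneg _)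
    _ = (lam ^ 8)⁻¹ * ((n : ℝ) * 45927 / (F : ℝ) ^ 4) := by rw [h2]; ring

/-- ★ STRETCH increment of a king piece under the floor: `schemeCoefR ≤ (1+α)·λ⁻⁸·kcoef F (x.2 − x.1)` (`cos² ≤ 1`). [g99] -/
theorem schemeCoefR_king_le {α lam : ℝ} (hα : 0 < α) (hlam : 0 < lam) {a b : E3} {w : ℤ → E3} {F : Cell 2 × ℤ → ℕ}
    {x : (Cell 2 × ℤ) × (Cell 2 × ℤ)} (hF : 0 < F (x.2 - x.1)) (hfl : lam ^ 2 * (F (x.2 - x.1) : ℝ) ≤ 9 * ‖bondVec a b w x‖ ^ 2)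
    (i : ℕ) : schemeCoefR α a b w kingN kingZ x i ≤ (1 + α) * (lam ^ 8)⁻¹ * kcoef F (x.2 - x.1) := by
  have hk := king_kernel_le (n := kingN x) hlam hF hfl
  have hc : cosSq a b w kingZ x i * aMinus ‖bondVec a b w x‖ ≤ 1 * aMinus ‖bondVec a b w x‖ :=
    mul_le_mul_of_nonneg_right (cosSq_le_one a b w kingZ x i) (aMinus_nonneg _)
  unfold schemeCoefR kcoef
  rw [kingN_eq_kingNv] at hk ⊢
  have h1 : (1 + α) * (kingNv (x.2 - x.1) : ℝ) * cosSq a b w kingZ x i * aMinus ‖bondVec a b w x‖ ≤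
      (1 + α) * ((kingNv (x.2 - x.1) : ℝ) * aMinus ‖bondVec a b w x‖) := by
    have := mul_le_mul_of_nonneg_left hc (by positivity : (0 : ℝ) ≤ (1 + α) * (kingNv (x.2 - x.1) : ℝ))
    nlinarith [this]
  exact h1.trans (by nlinarith [mul_le_mul_of_nonneg_left hk (by linarith : (0 : ℝ) ≤ 1 + α)])

/-- ★ NORM increment of a king piece under the floor: `schemeCoefN ≤ (1+α⁻¹)·λ⁻⁸·kcoef F (x.2 − x.1)` (`sin² ≤ 1`). [g99] -/
theorem schemeCoefN_king_le {α lam : ℝ} (hα : 0 < α) (hlam : 0 < lam) {a b : E3} {w : ℤ → E3} {F : Cell 2 × ℤ → ℕ}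
    {x : (Cell 2 × ℤ) × (Cell 2 × ℤ)} (hF : 0 < F (x.2 - x.1)) (hfl : lam ^ 2 * (F (x.2 - x.1) : ℝ) ≤ 9 * ‖bondVec a b w x‖ ^ 2)
    (i : ℕ) : schemeCoefN α a b w kingN kingZ x i ≤ (1 + α⁻¹) * (lam ^ 8)⁻¹ * kcoef F (x.2 - x.1) := by
  have hk := king_kernel_le (n := kingN x) hlam hF hfl
  have hα' : 0 < 1 + α⁻¹ := by positivity
  have hc : (1 - cosSq a b w kingZ x i) * aMinus ‖bondVec a b w x‖ ≤ 1 * aMinus ‖bondVec a b w x‖ :=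
    mul_le_mul_of_nonneg_right (by linarith [cosSq_nonneg a b w kingZ x i]) (aMinus_nonneg _)
  unfold schemeCoefN kcoef
  rw [kingN_eq_kingNv] at hk ⊢
  have h1 : (1 + α⁻¹) * (kingNv (x.2 - x.1) : ℝ) * (1 - cosSq a b w kingZ x i) * aMinus ‖bondVec a b w x‖ ≤
      (1 + α⁻¹) * ((kingNv (x.2 - x.1) : ℝ) * aMinus ‖bondVec a b w x‖) := by
    have := mul_le_mul_of_nonneg_left hc (by positivity : (0 : ℝ) ≤ (1 + α⁻¹) * (kingNv (x.2 - x.1) : ℝ))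
    nlinarith [this]
  exact h1.trans (by nlinarith [mul_le_mul_of_nonneg_left hk hα'.le])

/-! ### §3 Counting incidences per index vector -/

/-- ★ among pairs with a FIXED index difference `v`, the (pair, index) incidences on a fixed piece `y` number at most `kcnt v (y.2 − y.1)`:
for each index `i` at most one pair of difference `v` has its `i`-th node at `y.1`, and then `kstep v i = y.2 − y.1`. [g99] -/
theorem card_pieces_king_le (v : Cell 2 × ℤ) (y : (Cell 2 × ℤ) × (Cell 2 × ℤ)) (Xv : Finset ((Cell 2 × ℤ) × (Cell 2 × ℤ)))
    (hXv : ∀ x ∈ Xv, x.2 - x.1 = v) :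
    ∑ x ∈ Xv, ((Finset.range (kingN x)).filter fun i => piece kingZ x i = y).card ≤ kcnt v (y.2 - y.1) := by
  classical
  have h1 : ∀ x ∈ Xv, ((Finset.range (kingN x)).filter fun i => piece kingZ x i = y).card =
      ∑ i ∈ Finset.range (kingNv v), if piece kingZ x i = y then 1 else 0 := by
    intro x hx
    rw [Finset.card_filter, kingN_eq_kingNv, hXv x hx]
  rw [Finset.sum_congr rfl h1, Finset.sum_comm]
  unfold kcnt
  rw [Finset.card_filter]
  refine Finset.sum_le_sum fun i _ => ?_
  rw [← Finset.card_filter]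
  have hnode : ∀ x, piece kingZ x i = y → kingZ x i = y.1 ∧ kingZ x (i + 1) = y.2 := fun x hp =>
    ⟨(Prod.ext_iff.mp hp).1, (Prod.ext_iff.mp hp).2⟩
  have hstep : ∀ x ∈ Xv, piece kingZ x i = y → kstep v i = y.2 - y.1 := by
    intro x hx hp
    rw [← hXv x hx, ← kingZ_succ_sub_eq_kstep, (hnode x hp).1, (hnode x hp).2]
  by_cases hs : kstep v i = y.2 - y.1
  · rw [if_pos hs]
    refine Finset.card_le_one.mpr fun x hx x' hx' => ?_
    rw [Finset.mem_filter] at hx hx'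
    have e1 : kingZ x i = kingZ x' i := by
      rw [(hnode x hx.2).1, (hnode x' hx'.2).1]
    have e2 : x.1 = x'.1 := by
      unfold kingZ at e1
      rw [hXv x hx.1, hXv x' hx'.1] at e1
      exact add_right_cancel e1
    have e3 : x.2 = x'.2 := by
      have h := hXv x hx.1
      have h' := hXv x' hx'.1
      rw [← h', e2] at h
      exact sub_left_inj.mp h
    exact Prod.ext e2 e3
  · rw [if_neg hs, Nat.le_zero, Finset.card_eq_zero, Finset.filter_eq_empty_iff]
    exact fun x hx hp => hs (hstep x hx hp)

/-- regrouping by the index difference: a coefficient bounded by `K·kcoef F (x.2 − x.1)` sums over the incidences on `y` to at most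
`K · Σ_{v ∈ M} kcnt v (y.2 − y.1) · kcoef F v`, provided every pair of `X` has its difference in `M`. [g99] -/
theorem king_table_core {K : ℝ} (hK : 0 ≤ K) (X : Finset ((Cell 2 × ℤ) × (Cell 2 × ℤ))) (M : Finset (Cell 2 × ℤ))
    (F : Cell 2 × ℤ → ℕ) (coef : (Cell 2 × ℤ) × (Cell 2 × ℤ) → ℕ → ℝ) (hXM : ∀ x ∈ X, x.2 - x.1 ∈ M)
    (hcoef : ∀ x ∈ X, ∀ i, coef x i ≤ K * kcoef F (x.2 - x.1)) (y : (Cell 2 × ℤ) × (Cell 2 × ℤ)) :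
    (∑ x ∈ X, ∑ i ∈ Finset.range (kingN x), if piece kingZ x i = y then coef x i else 0) ≤
      K * ∑ v ∈ M, (kcnt v (y.2 - y.1) : ℝ) * kcoef F v := by
  classical
  have s1 : (∑ x ∈ X, ∑ i ∈ Finset.range (kingN x), if piece kingZ x i = y then coef x i else 0) ≤
      ∑ x ∈ X, ∑ i ∈ Finset.range (kingN x), if piece kingZ x i = y then K * kcoef F (x.2 - x.1) else 0 := by
    refine Finset.sum_le_sum fun x hx => Finset.sum_le_sum fun i _ => ?_
    split_ifs
    · exact hcoef x hx i
    · exact le_rfl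
  have s2 : ∀ x ∈ X, (∑ i ∈ Finset.range (kingN x), if piece kingZ x i = y then K * kcoef F (x.2 - x.1) else 0) =
      K * kcoef F (x.2 - x.1) * (((Finset.range (kingN x)).filter fun i => piece kingZ x i = y).card : ℝ) := by
    intro x _
    rw [← Finset.sum_filter, Finset.sum_const, nsmul_eq_mul, mul_comm]
  rw [Finset.sum_congr rfl s2] at s1
  refine s1.trans ?_
  have s3 : (∑ x ∈ X, K * kcoef F (x.2 - x.1) * (((Finset.range (kingN x)).filter fun i => piece kingZ x i = y).card : ℝ)) =
      ∑ v ∈ M, ∑ x ∈ X.filter (fun x => x.2 - x.1 = v),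
        K * kcoef F (x.2 - x.1) * (((Finset.range (kingN x)).filter fun i => piece kingZ x i = y).card : ℝ) :=
    (Finset.sum_fiberwise_of_maps_to hXM _).symm
  rw [s3, Finset.mul_sum]
  refine Finset.sum_le_sum fun v _ => ?_
  have hXv : ∀ x ∈ X.filter (fun x => x.2 - x.1 = v), x.2 - x.1 = v := fun x hx => (Finset.mem_filter.mp hx).2
  have s4 : (∑ x ∈ X.filter (fun x => x.2 - x.1 = v),
      K * kcoef F (x.2 - x.1) * (((Finset.range (kingN x)).filter fun i => piece kingZ x i = y).card : ℝ)) =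
      K * kcoef F v * ∑ x ∈ X.filter (fun x => x.2 - x.1 = v),
        (((Finset.range (kingN x)).filter fun i => piece kingZ x i = y).card : ℝ) := by
    rw [Finset.mul_sum]
    exact Finset.sum_congr rfl fun x hx => by rw [hXv x hx]
  rw [s4]
  have s5 : (∑ x ∈ X.filter (fun x => x.2 - x.1 = v), (((Finset.range (kingN x)).filter fun i => piece kingZ x i = y).card : ℝ)) ≤
      (kcnt v (y.2 - y.1) : ℝ) := by
    exact_mod_cast card_pieces_king_le v y _ hXv
  calc K * kcoef F v * _ ≤ K * kcoef F v * (kcnt v (y.2 - y.1) : ℝ) :=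
        mul_le_mul_of_nonneg_left s5 (mul_nonneg hK (kcoef_nonneg F v))
    _ = K * ((kcnt v (y.2 - y.1) : ℝ) * kcoef F v) := by ring

/-! ### §4 The middle-class domination theorem -/

/-- ★★ **THE BOX-AWARE KING REMAINDER**: for any class `P` whose far members have their index difference in the certified finite vector set
`M` with a positive squared-length floor `λ²·F v ≤ 9‖e_x‖²`, and any table `T` dominating `Σ_{v ∈ M} kcnt v δ · kcoef F v` for every step `δ`,
the king path system's scheme sums on `P` are dominated by `(1+α)·λ⁻⁸·T(δ_y)` and `(1+α⁻¹)·λ⁻⁸·T(δ_y)`. [g99] -/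
theorem schemeDominatedOnP_king_table {ϱ α lam : ℝ} (hα : 0 < α) (hlam : 0 < lam) {a b : E3} {w : ℤ → E3}
    (P : (Cell 2 × ℤ) × (Cell 2 × ℤ) → Prop) (M : Finset (Cell 2 × ℤ)) (F : Cell 2 × ℤ → ℕ) (T : Cell 2 × ℤ → ℝ)
    (hPM : ∀ x, ϱ < ‖bondVec a b w x‖ → P x →
      x.2 - x.1 ∈ M ∧ 0 < F (x.2 - x.1) ∧ lam ^ 2 * (F (x.2 - x.1) : ℝ) ≤ 9 * ‖bondVec a b w x‖ ^ 2)
    (hT : ∀ δ, ∑ v ∈ M, (kcnt v δ : ℝ) * kcoef F v ≤ T δ) :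
    SchemeDominatedOnP ϱ α a b w kingN kingZ P (fun y => (1 + α) * (lam ^ 8)⁻¹ * T (y.2 - y.1))
      (fun y => (1 + α⁻¹) * (lam ^ 8)⁻¹ * T (y.2 - y.1)) := by
  intro X hX y
  have hXM : ∀ x ∈ X, x.2 - x.1 ∈ M := fun x hx => (hPM x (hX x hx).1 (hX x hx).2).1
  have hK1 : (0 : ℝ) ≤ (1 + α) * (lam ^ 8)⁻¹ := by positivity
  have hK2 : (0 : ℝ) ≤ (1 + α⁻¹) * (lam ^ 8)⁻¹ := by positivity
  constructor
  · have h := king_table_core hK1 X M F (schemeCoefR α a b w kingN kingZ) hXM (fun x hx i => by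
      have hh := hPM x (hX x hx).1 (hX x hx).2
      have := schemeCoefR_king_le (a := a) (b := b) (w := w) hα hlam hh.2.1 hh.2.2 i
      linarith [this]) y
    exact h.trans (by nlinarith [mul_le_mul_of_nonneg_left (hT (y.2 - y.1)) hK1])
  · have h := king_table_core hK2 X M F (schemeCoefN α a b w kingN kingZ) hXM (fun x hx i => by
      have hh := hPM x (hX x hx).1 (hX x hx).2
      have := schemeCoefN_king_le (a := a) (b := b) (w := w) hα hlam hh.2.1 hh.2.2 i
      linarith [this]) y
    exact h.trans (by nlinarith [mul_le_mul_of_nonneg_left (hT (y.2 - y.1)) hK2])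

end Summit.AtomisticToContinuum.Crystallization.Theorems.ChartedZeroExcessLayeredLatticeLiouville
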